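import Literature.AnabelianGeometry.AbsoluteAnabelian.AbsTopIProp410TemperedModelResidues
import Literature.AnabelianGeometry.AbsoluteAnabelian.AbsTopIProp410SurjectiveCaseProofs
import Literature.AnabelianGeometry.SemiGraphs.TemperedFreeThreeSlim
import Literature.AnabelianGeometry.SemiGraphs.TemperedProfiniteProducts
import Literature.AnabelianGeometry.SemiGraphs.OncePuncturedTemperedGroupPadicWitness
import HarnessLib

/-!
# [AbsTopI] Prop 4.10 (iii) at the construction HOLDS at a NON-COMPACT tempered model:
# `Γ₃ × G_{ℚ_p} ↠ Γ₂ × G_{ℚ_p}` (one-loop dual graphs on both sides; non-vacuity, proof-only)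

S. Mochizuki, *Topics in Absolute Anabelian Geometry I: Generalities* [AbsTopI] (2012), §0 p. 8,
Def 4.2 (iii)(c) p. 50, Prop 4.10 (iii) p. 60 ("the natural homomorphism `Π^tp_X → Π^tp_Y` [...] may be
reconstructed [...] as the natural morphism from `Π^tp_X` to the co-free completion of `Π^tp_X` with
respect to `Π̂^tp_Y`"); manuscript pagination, lit key `paper:url-11ac98ba15fc`, read on the page.
[SemiAnbd] Def 3.1 (i) p. 33, Ex 3.10 pp. 43–45; [EtTh] §1 p. 12: abc-iut-w5-d218's fibre products
`Γₙ = F̂ₙ ×_Ẑ ℤ` (tempered, slim, non-compact, `pr₁ : Γₙ → F̂ₙ` the profinite completion).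

Context: node AbsTopI:Prop4.10(iii) of `HOME/plan/L4/SUBDAG-AbsTopI-Prop410.md`.  Its closers
`DeCuspidalization.prop410iii_of_fDelta_surjective` (`AbsTopIProp410SurjectiveCaseProofs.lean`) give
both clauses AT THE CONSTRUCTION over {`Δ^tp_X ↠ Δ^tp_Y` (row iii.L03), (CF_Δ)_Y, `hmin_X`, `hmin_Y`,
tfg `Δ^tp_X`, `dX`, `dY`}.  So far the closers were INHABITED only at a compact model
(`AbsTopIProp410CompactModelNonVacuity.lean`: profinite `Π^tp`, every dual graph a tree, the co-free
completion idle).  THIS FILE inhabits them at a genuinely TEMPERED datum: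
* `X`: `Π^tp_X := Γ₃ × G_{ℚ_p}`, `Γ₃ = F̂₃ ×_Ẑ ℤ` for the completed exponent sum `ê_c` of the third
  generator `c` of `F₃ = ⟨a, b, c⟩`; one cusp with inertia `îa(Ẑ) × 0 ≅ Ẑ`;
* `Y`: `Π^tp_Y := Γ₂ × G_{ℚ_p}`, `Γ₂ = F̂₂ ×_Ẑ ℤ` for the completed exponent sum `ê_x` of the FIRST
  generator `x` of `F₂ = ⟨x, y⟩` (the convention of w5-d218's slimness theorem);
* `f := φ × id`, `φ(u, n) := (π̂ u, n)` with `π̂` completing `π′ : a ↦ 1, b ↦ y, c ↦ x` (so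
  `ê_x ∘ π̂ = ê_c` and `φ : Γ₃ → Γ₂` is well defined and ONTO: `(ŝ z, n) ↦ (z, n)`); `f̂ := π̂ × id`
  (kernel clause `ker_prodMap_id_eq`).
Every hypothesis of the closers is PROVED here: `Δ^tp_X ↠ Δ^tp_Y` onto; (CF_Δ)_Y and `hmin_X`,
`hmin_Y` by `TemperedFibreProduct.cofreeCore_cofinal_index` / `exists_isMinimalCofreeIn_index`
(`AbsTopIProp410TemperedModelResidues.lean`: the compact slice `Γ₀ × 1` meets every index in its
minimal co-free subgroup — INFINITE index, "one loop"); tfg by density of the graphs of `F₃`, `F₂`;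
`dX`, `dY` (tempered: `IsTempered.prod_of_profinite`; slim: `centralizer_eq_bot_of_isOpen₃`,
`TemperedFibreProduct.isSlimGroup`, [pGC] Lem 15.8 for `G_{ℚ_p}`; Galois-countable).  Whence
**`Prop410iiiAt E ∧ Prop410iiiDeltaAt E` with `Π^tp_X`, `Π^tp_Y` NOT compact**
(`Prop410iiiAt.exists_temperedModel`): the §0 co-free completion of `Γ₃ × G_{ℚ_p}` with respect to
`F̂₂ × G_{ℚ_p}` IS `Γ₂ × G_{ℚ_p}` — recovering a non-profinite tempered topology from profinite data.

HONEST LABEL: direct-product model (trivial Galois action on `Δ`), imitating a once-punctured Tate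
curve minus a point ↠ the Tate curve minus a point; not the tempered fundamental group of a curve (none
is in the tree); consistency evidence for the closers + residue list, not an endorsement.  Proof-only
(no `def`/instance/named fact; FACT-LIST untouched).  No side taken on [IUTchIII] Cor 3.12; typed ≠ proved.
-/

noncomputable section

namespace Literature.AnabelianGeometry.AbsoluteAnabelian.AbsTopI.Prop410

open _root_.Topology _root_.Filter _root_.Set _root_.Function
open Literature.AnabelianGeometry.SemiGraphs
open Literature.AnabelianGeometry.AbsoluteAnabelian.AbsTopI
open Literature.IUT.HodgeTheaters (profiniteCompletion toCompletion toCompletion_int_injective)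
open Literature.AlgebraicGeometry.Frobenioids (IsSlimGroup)
open TemperedFibreProduct

/-- **[AbsTopI] Prop 4.10 (iii) at the construction holds at a NON-COMPACT tempered
de-cuspidalization model** `Γ₃ × G_{ℚ_p} ↠ Γ₂ × G_{ℚ_p}` (module docstring): both clauses of the
node, with `Δ^tp_X ↠ Δ^tp_Y` onto, `dX`, `dY`, a cusp on `X`, and neither `Π^tp` compact.
[cite: MochizukiAbsTopI2012, Prop 4.10 (iii) p.60] -/
theorem Prop410iiiAt.exists_temperedModel (p : ℕ) [Fact p.Prime] :
    ∃ (X Y : TemperedCurve p) (E : DeCuspidalization X Y),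
      Prop410iiiAt E ∧ Prop410iiiDeltaAt E ∧ Function.Surjective E.fDelta ∧
      Nonempty X.GroupLevelData ∧ Nonempty Y.GroupLevelData ∧
      ¬ CompactSpace X.PiTemp ∧ ¬ CompactSpace Y.PiTemp ∧ (∃ x : X.Pt, X.IsCusp x) ∧
      X.K = ⊥ ∧ Y.K = ⊥ := by
  classical
  haveI : IsGalois ℚ_[p] (AlgebraicClosure ℚ_[p]) := {}
  haveI : T2Space (GQp p) := krullTopology_t2
  let P3 : ProfiniteGrp.{0} := profiniteCompletion (FreeGroup (Fin 3))
  let P2 : ProfiniteGrp.{0} := profiniteCompletion (FreeGroup (Fin 2))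
  let Zh : ProfiniteGrp.{0} := profiniteCompletion (Multiplicative ℤ)
  let η₃ : FreeGroup (Fin 3) →* P3 := toCompletion _; let η₂ : FreeGroup (Fin 2) →* P2 := toCompletion _
  let ι : Multiplicative ℤ →* Zh := toCompletion (Multiplicative ℤ)
  let a : FreeGroup (Fin 3) := FreeGroup.of 0; let b : FreeGroup (Fin 3) := FreeGroup.of 1
  let c : FreeGroup (Fin 3) := FreeGroup.of 2
  let ex : Fin 3 → FreeGroup (Fin 3) →* Multiplicative ℤ := fun i =>
    FreeGroup.lift fun j => if j = i then Multiplicative.ofAdd (1 : ℤ) else 1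
  let σa := ex 0; let σb := ex 1; let σc := ex 2
  have hσaa : σa a = Multiplicative.ofAdd 1 := by simp [σa, ex, a]
  have hσab : σa b = 1 := by simp [σa, ex, b]
  have hσba : σb a = 1 := by simp [σb, ex, a]
  have hσbb : σb b = Multiplicative.ofAdd 1 := by simp [σb, ex, b]
  have hσca : σc a = 1 := by simp [σc, ex, a]
  have hσcb : σc b = 1 := by simp [σc, ex, b]
  have hσcc : σc c = Multiplicative.ofAdd 1 := by simp [σc, ex, c]
  -- rank two: `x = of 0`, `y = of 1`, exponent sums `τx`, `τy`
  let τ : Fin 2 → FreeGroup (Fin 2) →* Multiplicative ℤ := fun i =>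
    FreeGroup.lift fun j => if j = i then Multiplicative.ofAdd (1 : ℤ) else 1
  let τx := τ 0; let τy := τ 1
  have hτxx : τx (FreeGroup.of 0) = Multiplicative.ofAdd 1 := by simp [τx, τ]
  have hτxy : τx (FreeGroup.of 1) = 1 := by simp [τx, τ]
  have hτyx : τy (FreeGroup.of 0) = 1 := by simp [τy, τ]
  have hτyy : τy (FreeGroup.of 1) = Multiplicative.ofAdd 1 := by simp [τy, τ]
  -- `π′ : a ↦ 1, b ↦ y, c ↦ x`, section `s′ : x ↦ c, y ↦ b`
  let π : FreeGroup (Fin 3) →* FreeGroup (Fin 2) :=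
    FreeGroup.lift ![(1 : FreeGroup (Fin 2)), FreeGroup.of 1, FreeGroup.of 0]
  let s : FreeGroup (Fin 2) →* FreeGroup (Fin 3) := FreeGroup.lift ![FreeGroup.of (2 : Fin 3), FreeGroup.of 1]
  have hπa : π a = 1 := by simp [π, a]
  have hπs : ∀ w : FreeGroup (Fin 2), π (s w) = w := proj₃'_section
  have hτxπ : ∀ u, τx (π u) = σc u := expSum₀_comp_proj₃'
  have hkerπ : π.ker ≤ Subgroup.normalClosure ({FreeGroup.of 0} : Set (FreeGroup (Fin 3))) :=
    ker_proj₃'_le_normalClosure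
  -- completions
  let e : P3 →ₜ* Zh := (ProfiniteGrp.ProfiniteCompletion.lift (GrpCat.ofHom (ι.comp σc))).hom
  let êa : P3 →ₜ* Zh := (ProfiniteGrp.ProfiniteCompletion.lift (GrpCat.ofHom (ι.comp σa))).hom
  let êb : P3 →ₜ* Zh := (ProfiniteGrp.ProfiniteCompletion.lift (GrpCat.ofHom (ι.comp σb))).hom
  let e₂ : P2 →ₜ* Zh := (ProfiniteGrp.ProfiniteCompletion.lift (GrpCat.ofHom (ι.comp τx))).hom
  let êy : P2 →ₜ* Zh := (ProfiniteGrp.ProfiniteCompletion.lift (GrpCat.ofHom (ι.comp τy))).hom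
  let πh : P3 →ₜ* P2 := (ProfiniteGrp.ProfiniteCompletion.lift (GrpCat.ofHom (η₂.comp π))).hom
  let sh : P2 →ₜ* P3 := (ProfiniteGrp.ProfiniteCompletion.lift (GrpCat.ofHom (η₃.comp s))).hom
  let îa : Zh →ₜ* P3 :=
    (ProfiniteGrp.ProfiniteCompletion.lift (GrpCat.ofHom (η₃.comp (zpowersHom _ a)))).hom
  let îb : Zh →ₜ* P3 :=
    (ProfiniteGrp.ProfiniteCompletion.lift (GrpCat.ofHom (η₃.comp (zpowersHom _ b)))).hom
  let îx : Zh →ₜ* P2 :=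
    (ProfiniteGrp.ProfiniteCompletion.lift (GrpCat.ofHom (η₂.comp (zpowersHom _ (FreeGroup.of 0))))).hom
  let îy : Zh →ₜ* P2 :=
    (ProfiniteGrp.ProfiniteCompletion.lift (GrpCat.ofHom (η₂.comp (zpowersHom _ (FreeGroup.of 1))))).hom
  have he : ∀ g, e (η₃ g) = ι (σc g) := fun g => lift_hom_toCompletion Zh (ι.comp σc) g
  have hêa : ∀ g, êa (η₃ g) = ι (σa g) := fun g => lift_hom_toCompletion Zh (ι.comp σa) g
  have hêb : ∀ g, êb (η₃ g) = ι (σb g) := fun g => lift_hom_toCompletion Zh (ι.comp σb) g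
  have he₂ : ∀ w, e₂ (η₂ w) = ι (τx w) := fun w => lift_hom_toCompletion Zh (ι.comp τx) w
  have hêy : ∀ w, êy (η₂ w) = ι (τy w) := fun w => lift_hom_toCompletion Zh (ι.comp τy) w
  have hπh : ∀ g, πh (η₃ g) = η₂ (π g) := fun g => lift_hom_toCompletion P2 (η₂.comp π) g
  have hsh : ∀ w, sh (η₂ w) = η₃ (s w) := fun w => lift_hom_toCompletion P3 (η₃.comp s) w
  have hîa : ∀ k : ℤ, îa (ι (Multiplicative.ofAdd k)) = η₃ (a ^ k) := fun k => by
    rw [lift_hom_toCompletion P3 (η₃.comp (zpowersHom _ a))]; simp [zpowersHom_apply]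
  have hîb : ∀ k : ℤ, îb (ι (Multiplicative.ofAdd k)) = η₃ (b ^ k) := fun k => by
    rw [lift_hom_toCompletion P3 (η₃.comp (zpowersHom _ b))]; simp [zpowersHom_apply]
  have hîx : ∀ k : ℤ, îx (ι (Multiplicative.ofAdd k)) = η₂ (FreeGroup.of 0 ^ k) := fun k => by
    rw [lift_hom_toCompletion P2 (η₂.comp (zpowersHom _ (FreeGroup.of 0)))]; simp [zpowersHom_apply]
  have hîy : ∀ k : ℤ, îy (ι (Multiplicative.ofAdd k)) = η₂ (FreeGroup.of 1 ^ k) := fun k => by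
    rw [lift_hom_toCompletion P2 (η₂.comp (zpowersHom _ (FreeGroup.of 1)))]; simp [zpowersHom_apply]
  have hιinj : Injective ι := toCompletion_int_injective
  have heîa : ∀ t, e (îa t) = 1 := apply_apply_eq_one_of a σc hσca e îa he hîa
  have hêaîa : ∀ t, êa (îa t) = t := apply_apply_eq_self_of a σa hσaa êa îa hêa hîa
  have hd3 : DenseRange η₃ := ProfiniteGrp.ProfiniteCompletion.denseRange (GrpCat.of (FreeGroup (Fin 3)))
  have hd2 : DenseRange η₂ := ProfiniteGrp.ProfiniteCompletion.denseRange (GrpCat.of (FreeGroup (Fin 2)))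
  have he₂πh : ∀ u, e₂ (πh u) = e u := by
    have h := hd3.equalizer (e₂.continuous.comp πh.continuous) e.continuous (by
      funext u; change e₂ (πh (η₃ u)) = e (η₃ u); rw [hπh, he₂, hτxπ, he])
    exact fun u => congr_fun h u
  have hZ : ∀ A : Subgroup (Multiplicative ℤ), A.FiniteIndex →
      ∀ k : Multiplicative ℤ, ι k ∈ closure (ι '' (A : Set (Multiplicative ℤ))) → k ∈ A :=
    fun A hA k hk => by haveI := hA; exact mem_of_toCompletion_mem_closure A k hk
  haveI : SecondCountableTopology P3 := secondCountableTopology_profiniteCompletion_freeGroup (Fin 3)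
  haveI : SecondCountableTopology P2 := secondCountableTopology_profiniteCompletion_freeGroup (Fin 2)
  haveI := Literature.NumberTheory.LocalFields.secondCountableTopology_galQp p
  have hslimG : IsSlimGroup (GQp p) :=
    IsSubpadicFor.isSlimGroup_absoluteGaloisGroup (AbsTopIII.IsSubpadicFor.padic p)
  -- the fibre products `Γ₃` (for `ê_c`) and `Γ₂` (for `ê_x`)
  let Γ : Subgroup (P3 × Multiplicative ℤ) :=
    (e.toMonoidHom.comp (MonoidHom.fst P3 (Multiplicative ℤ))).eqLocus
      (ι.comp (MonoidHom.snd P3 (Multiplicative ℤ)))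
  have hΓ : ∀ q : P3 × Multiplicative ℤ, q ∈ Γ ↔ e q.1 = ι q.2 := fun q => Iff.rfl
  let Γ₂ : Subgroup (P2 × Multiplicative ℤ) :=
    (e₂.toMonoidHom.comp (MonoidHom.fst P2 (Multiplicative ℤ))).eqLocus
      (ι.comp (MonoidHom.snd P2 (Multiplicative ℤ)))
  have hΓ₂ : ∀ q : P2 × Multiplicative ℤ, q ∈ Γ₂ ↔ e₂ q.1 = ι q.2 := fun q => Iff.rfl
  have hηN : ∀ N : Subgroup (FreeGroup (Fin 3)), N.Normal → N.FiniteIndex →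
      ∃ V : OpenNormalSubgroup P3, ∀ g, η₃ g ∈ V ↔ g ∈ N := fun N _ _ => exists_openNormal_eta_mem_iff N
  have hηN₂ : ∀ N : Subgroup (FreeGroup (Fin 2)), N.Normal → N.FiniteIndex →
      ∃ V : OpenNormalSubgroup P2, ∀ g, η₂ g ∈ V ↔ g ∈ N := fun N _ _ => exists_openNormal_eta_mem_iff N
  have hs : Surjective σc := fun n => ⟨c ^ n.toAdd, by
    rw [map_zpow, hσcc, ← ofAdd_zsmul, smul_eq_mul, mul_one]; rfl⟩
  have hs₂ : Surjective τx := fun n => ⟨FreeGroup.of 0 ^ n.toAdd, by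
    rw [map_zpow, hτxx, ← ofAdd_zsmul, smul_eq_mul, mul_one]; rfl⟩
  haveI : SecondCountableTopology Γ := TemperedFibreProduct.secondCountableTopology Γ
  haveI : SecondCountableTopology Γ₂ := TemperedFibreProduct.secondCountableTopology Γ₂
  have hTΓ : IsTempered Γ := isTempered e ι Γ hΓ
  have hTΓ₂ : IsTempered Γ₂ := isTempered e₂ ι Γ₂ hΓ₂
  have hSlimΓ : IsSlimGroup Γ := ⟨centralizer_eq_bot_of_isOpen₃ e êa êb îa îb σc σa σb hσca hσcb
    hσaa hσab hσba hσbb he hêa hêb hîa hîb hιinj Γ hΓ⟩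
  have hSlimΓ₂ : IsSlimGroup Γ₂ :=
    TemperedFibreProduct.isSlimGroup e₂ êy îx îy τx τy hτxx hτxy hτyx hτyy he₂ hêy hîx hîy hιinj Γ₂ hΓ₂
  let toHatΓ : Γ →ₜ* P3 :=
    ⟨(MonoidHom.fst P3 (Multiplicative ℤ)).comp Γ.subtype, continuous_fst.comp continuous_subtype_val⟩
  let toHatΓ₂ : Γ₂ →ₜ* P2 :=
    ⟨(MonoidHom.fst P2 (Multiplicative ℤ)).comp Γ₂.subtype, continuous_fst.comp continuous_subtype_val⟩
  have hPC : IsProfiniteCompletion toHatΓ :=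
    isProfiniteCompletion_fst e ι Γ hΓ η₃ hd3 hηN σc hs he hZ toHatΓ fun _ => rfl
  have hPC₂ : IsProfiniteCompletion toHatΓ₂ :=
    isProfiniteCompletion_fst e₂ ι Γ₂ hΓ₂ η₂ hd2 hηN₂ τx hs₂ he₂ hZ toHatΓ₂ fun _ => rfl
  have hinjΓ : Injective toHatΓ := fst_injective e ι Γ hΓ hιinj
  have hinjΓ₂ : Injective toHatΓ₂ := fst_injective e₂ ι Γ₂ hΓ₂ hιinj
  have hsndΓ : Surjective ((MonoidHom.snd P3 (Multiplicative ℤ)).comp Γ.subtype) :=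
    snd_surjective_of e ι Γ hΓ (exists_apply_eq_iota e ι η₃ σc hs he)
  have hsndΓ₂ : Surjective ((MonoidHom.snd P2 (Multiplicative ℤ)).comp Γ₂.subtype) :=
    snd_surjective_of e₂ ι Γ₂ hΓ₂ (exists_apply_eq_iota e₂ ι η₂ τx hs₂ he₂)
  have hgrmem : ∀ g : FreeGroup (Fin 3), (η₃.prod σc) g ∈ Γ := fun g => (hΓ _).mpr (he g)
  have hgrmem₂ : ∀ g : FreeGroup (Fin 2), (η₂.prod τx) g ∈ Γ₂ := fun g => (hΓ₂ _).mpr (he₂ g)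
  have htfgΓ : IsTopologicallyFinitelyGenerated Γ := by
    refine ⟨⟨_, topologicalClosure_closure_graph_eq_top e ι Γ hΓ η₃ hd3 σc hs he
      hZ ((η₃.prod σc).codRestrict Γ hgrmem) (fun _ => rfl)
      (Finset.univ.image (FreeGroup.of : Fin 3 → FreeGroup (Fin 3))) ?_⟩⟩
    rw [Finset.coe_image, Finset.coe_univ, Set.image_univ]; exact FreeGroup.closure_range_of _
  have htfgΓ₂ : IsTopologicallyFinitelyGenerated Γ₂ := by
    refine ⟨⟨_, topologicalClosure_closure_graph_eq_top e₂ ι Γ₂ hΓ₂ η₂ hd2 τx hs₂ he₂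
      hZ ((η₂.prod τx).codRestrict Γ₂ hgrmem₂) (fun _ => rfl)
      (Finset.univ.image (FreeGroup.of : Fin 2 → FreeGroup (Fin 2))) ?_⟩⟩
    rw [Finset.coe_image, Finset.coe_univ, Set.image_univ]; exact FreeGroup.closure_range_of _
  -- the cusp on `X`: `I = îa(Ẑ) × 0 ≤ Γ`, `D = I × G_{ℚ_p}`
  have hγt : ∀ t, ((îa t, (1 : Multiplicative ℤ)) : P3 × Multiplicative ℤ) ∈ Γ := fun t =>
    (hΓ _).mpr (by change e (îa t) = ι 1; rw [heîa, map_one])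
  let I : Subgroup Γ := ((îa.toMonoidHom.range).prod (⊥ : Subgroup (Multiplicative ℤ))).comap Γ.subtype
  have hImem : ∀ γ : Γ, γ ∈ I ↔ (∃ t, îa t = (γ : P3 × Multiplicative ℤ).1) ∧
      (γ : P3 × Multiplicative ℤ).2 = 1 := fun γ => by
    rw [Subgroup.mem_comap, Subgroup.mem_prod, MonoidHom.mem_range, Subgroup.mem_bot]; rfl
  have hIclosed : IsClosed (I : Set Γ) := by
    have hset : (I : Set Γ) = Subtype.val ⁻¹' (Set.range îa ×ˢ {1}) := by
      ext γ; rw [SetLike.mem_coe, hImem]; rfl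
    rw [hset]
    exact ((isCompact_range îa.continuous).isClosed.prod (isClosed_singleton)).preimage
      continuous_subtype_val
  let D : Subgroup (Γ × GQp p) := I.prod ⊤
  have hDmem : ∀ x : Γ × GQp p, x ∈ D ↔ x.1 ∈ I := fun x => by simp [D, Subgroup.mem_prod]
  have hDclosed : IsClosed (D : Set (Γ × GQp p)) := by
    have : (D : Set (Γ × GQp p)) = Prod.fst ⁻¹' (I : Set Γ) := by ext x; exact hDmem x
    exact this ▸ hIclosed.preimage continuous_fst
  let sndG : Γ × GQp p →ₜ* GQp p := ContinuousMonoidHom.snd _ _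
  have hsndD : sndG '' (D : Set (Γ × GQp p)) = Set.univ :=
    Set.eq_univ_of_forall fun g => ⟨(1, g), (hDmem _).2 I.one_mem, rfl⟩
  have hinertia : Nonempty (↥(D ⊓ sndG.toMonoidHom.ker) ≃ₜ* ZHat) := by
    refine ⟨{ toFun := fun x => êa ((x.1.1 : P3 × Multiplicative ℤ).1)
              invFun := fun t => ⟨(⟨(îa t, 1), hγt t⟩, 1),
                (hDmem _).2 ((hImem _).2 ⟨⟨t, rfl⟩, rfl⟩), (MonoidHom.mem_ker).2 rfl⟩
              left_inv := fun x => ?_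
              right_inv := fun t => hêaîa t
              map_mul' := fun x y => by
                change êa (((x : Γ × GQp p) * y).1 : P3 × Multiplicative ℤ).1 =
                  êa ((x : Γ × GQp p).1 : P3 × Multiplicative ℤ).1 *
                    êa ((y : Γ × GQp p).1 : P3 × Multiplicative ℤ).1
                rw [← map_mul]; rfl
              continuous_toFun := êa.continuous.comp ((continuous_fst.comp
                continuous_subtype_val).comp (continuous_fst.comp continuous_subtype_val))
              continuous_invFun := by
                refine Continuous.subtype_mk (Continuous.prodMk ?_ continuous_const) _
                exact (Continuous.prodMk îa.continuous continuous_const).subtype_mk _ }⟩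
    obtain ⟨⟨γ, g⟩, hx⟩ := x
    have hg : g = 1 := (MonoidHom.mem_ker).1 (Subgroup.mem_inf.1 hx).2
    obtain ⟨⟨u, hu⟩, h2⟩ := (hImem _).1 ((hDmem _).1 (Subgroup.mem_inf.1 hx).1)
    apply Subtype.ext
    change ((⟨(îa (êa (γ : P3 × Multiplicative ℤ).1), 1), _⟩ : Γ), (1 : GQp p)) = (γ, g)
    refine Prod.ext (Subtype.ext (Prod.ext ?_ h2.symm)) hg.symm
    change îa (êa (γ : P3 × Multiplicative ℤ).1) = (γ : P3 × Multiplicative ℤ).1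
    rw [← hu, hêaîa]
  let X : TemperedCurve p :=
    { K := ⊥, finiteDimensional_K := inferInstance, PiTemp := Γ × GQp p, aug := sndG
      range_aug := by
        rw [IntermediateField.fixingSubgroup_bot]; exact MonoidHom.range_eq_top.mpr Prod.snd_surjective
      PiHat := P3 × GQp p
      toHat := toHatΓ.prodMap (ContinuousMonoidHom.id (GQp p))
      isProfiniteCompletion_toHat := hPC.prodMap_id
      toHat_injective := fun x y h => by
        have h1 := congrArg Prod.fst h; have h2 := congrArg Prod.snd h
        exact Prod.ext (hinjΓ h1) h2
      augHat := ContinuousMonoidHom.snd _ _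
      augHat_comp := fun _ => rfl
      Pt := Unit, IsCusp := fun _ => True, decomp := fun _ => D, isClosed_decomp := fun _ => hDclosed
      isOpen_aug_decomp := fun _ => by
        change IsOpen (sndG '' (D : Set (Γ × GQp p))); rw [hsndD]; exact isOpen_univ
      inertia_eq_bot := fun _ h => (h trivial).elim
      inertia_equiv_zHat := fun _ _ => hinertia }
  let sndG₂ : Γ₂ × GQp p →ₜ* GQp p := ContinuousMonoidHom.snd _ _
  let Y : TemperedCurve p :=
    { K := ⊥, finiteDimensional_K := inferInstance, PiTemp := Γ₂ × GQp p, aug := sndG₂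
      range_aug := by
        rw [IntermediateField.fixingSubgroup_bot]; exact MonoidHom.range_eq_top.mpr Prod.snd_surjective
      PiHat := P2 × GQp p
      toHat := toHatΓ₂.prodMap (ContinuousMonoidHom.id (GQp p))
      isProfiniteCompletion_toHat := hPC₂.prodMap_id
      toHat_injective := fun x y h => by
        have h1 := congrArg Prod.fst h; have h2 := congrArg Prod.snd h
        exact Prod.ext (hinjΓ₂ h1) h2
      augHat := ContinuousMonoidHom.snd _ _, augHat_comp := fun _ => rfl
      Pt := PEmpty, IsCusp := fun x => x.elim, decomp := fun x => x.elim
      isClosed_decomp := fun x => x.elim, isOpen_aug_decomp := fun x => x.elim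
      inertia_eq_bot := fun x => x.elim, inertia_equiv_zHat := fun x => x.elim }
  -- the tempered arrow `φ : Γ₃ → Γ₂`, `(u, n) ↦ (π̂ u, n)`, and `f = φ × id`, `f̂ = π̂ × id`
  have hφmem : ∀ γ : Γ, ((πh (γ : P3 × Multiplicative ℤ).1, (γ : P3 × Multiplicative ℤ).2) :
      P2 × Multiplicative ℤ) ∈ Γ₂ := fun γ =>
    (hΓ₂ _).mpr (by change e₂ (πh _) = ι _; rw [he₂πh]; exact (hΓ _).mp γ.2)
  let φ : Γ →ₜ* Γ₂ :=
    { toFun := fun γ => ⟨_, hφmem γ⟩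
      map_one' := Subtype.ext (Prod.ext (by simp) rfl)
      map_mul' := fun x y => Subtype.ext (Prod.ext (by simp) rfl)
      continuous_toFun := ((πh.continuous.comp (continuous_fst.comp continuous_subtype_val)).prodMk
        (continuous_snd.comp continuous_subtype_val)).subtype_mk _ }
  let fHat : P3 × GQp p →ₜ* P2 × GQp p := πh.prodMap (ContinuousMonoidHom.id (GQp p))
  have hinertia_eq : (X.inertia ()).map X.toHat.toMonoidHom =
      (îa.toMonoidHom.range).prod (⊥ : Subgroup (GQp p)) := by
    ext y
    constructor
    · rintro ⟨x, hx, rfl⟩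
      obtain ⟨⟨t, ht⟩, -⟩ := (hImem _).1 ((hDmem _).1 (Subgroup.mem_inf.1 hx).1)
      have hg : x.2 = 1 := (MonoidHom.mem_ker).1 (Subgroup.mem_inf.1 hx).2
      exact Subgroup.mem_prod.mpr ⟨⟨t, ht⟩, by rw [Subgroup.mem_bot]; exact hg⟩
    · intro hy
      obtain ⟨⟨t, ht⟩, hy2⟩ := Subgroup.mem_prod.mp hy
      rw [Subgroup.mem_bot] at hy2
      refine ⟨(⟨(îa t, 1), hγt t⟩, 1), Subgroup.mem_inf.2 ⟨(hDmem _).2 ((hImem _).2 ⟨⟨t, rfl⟩, rfl⟩),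
        (MonoidHom.mem_ker).2 rfl⟩, ?_⟩
      exact Prod.ext ht hy2.symm
  let E : DeCuspidalization X Y :=
    { f := φ.prodMap (ContinuousMonoidHom.id (GQp p)), fHat := fHat
      toHat_comp := fun _ => rfl, aug_comp := fun _ => rfl
      fHat_surjective := fun z => ⟨(sh z.1, z.2), Prod.ext (apply_sh_eq π s hπs πh sh hπh hsh z.1) rfl⟩
      x := (), isCusp := trivial
      rational := by
        change sndG '' (D : Set (Γ × GQp p)) = Set.range sndG
        rw [hsndD]; exact (Set.range_eq_univ.mpr Prod.snd_surjective).symm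
      ker_fHat := by
        rw [hinertia_eq]; exact ker_prodMap_id_eq π s hπs hπa hkerπ πh sh îa hπh hsh hîa }
  -- `Δ^tp = Γ × 1`
  have hΔX : ∀ x : Γ × GQp p, x ∈ X.DeltaTemp ↔ x.2 = 1 := fun x => MonoidHom.mem_ker
  have hΔY : ∀ y : Γ₂ × GQp p, y ∈ Y.DeltaTemp ↔ y.2 = 1 := fun y => MonoidHom.mem_ker
  have hΔXeq : X.DeltaTemp = (⊤ : Subgroup Γ).prod (⊥ : Subgroup (GQp p)) := by
    ext x; rw [hΔX, Subgroup.mem_prod, Subgroup.mem_bot]; simp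
  have hΔYeq : Y.DeltaTemp = (⊤ : Subgroup Γ₂).prod (⊥ : Subgroup (GQp p)) := by
    ext y; rw [hΔY, Subgroup.mem_prod, Subgroup.mem_bot]; simp
  have eΔ : ∀ (Q : Type) [Group Q] [TopologicalSpace Q] (H : Subgroup (Q × GQp p)),
      (∀ x, x ∈ H ↔ x.2 = 1) → Nonempty (Q ≃ₜ* H) := fun Q _ _ H hH =>
    ⟨{ toFun := fun z => ⟨(z, 1), (hH _).2 rfl⟩
       invFun := fun y => y.1.1
       left_inv := fun z => rfl
       right_inv := fun y => Subtype.ext (Prod.ext rfl ((hH _).1 y.2).symm)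
       map_mul' := fun z w => Subtype.ext (Prod.ext rfl (by simp))
       continuous_toFun := (continuous_id.prodMk continuous_const).subtype_mk _
       continuous_invFun := continuous_fst.comp continuous_subtype_val }⟩
  obtain ⟨eX⟩ := eΔ Γ X.DeltaTemp hΔX
  obtain ⟨eY⟩ := eΔ Γ₂ Y.DeltaTemp hΔY
  -- surjectivity of `Δ^tp_X → Δ^tp_Y` (via the section `ŝ`)
  have hsurj : Function.Surjective E.fDelta := by
    rintro ⟨⟨γ₂, g⟩, hy⟩
    have hg : g = 1 := (hΔY _).1 hy
    obtain ⟨⟨z, n⟩, hzn⟩ := γ₂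
    have hxn : ((sh z, n) : P3 × Multiplicative ℤ) ∈ Γ :=
      (hΓ _).mpr (by change e (sh z) = ι n; rw [← he₂πh, apply_sh_eq π s hπs πh sh hπh hsh z]; exact hzn)
    refine ⟨⟨(⟨(sh z, n), hxn⟩, 1), (hΔX _).2 rfl⟩, Subtype.ext (Prod.ext (Subtype.ext (Prod.ext ?_ rfl)) hg.symm)⟩
    exact apply_sh_eq π s hπs πh sh hπh hsh z
  -- parameter bundles
  have hTX : IsTempered (Γ × GQp p) := hTΓ.prod_of_profinite
  have hTY : IsTempered (Γ₂ × GQp p) := hTΓ₂.prod_of_profinite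
  have hkerX : (X.augK X.galoisIdentification).toMonoidHom.ker = X.DeltaTemp :=
    X.ker_augK X.galoisIdentification
  have hkerY : (Y.augK Y.galoisIdentification).toMonoidHom.ker = Y.DeltaTemp :=
    Y.ker_augK Y.galoisIdentification
  have dX : X.GroupLevelData :=
    { galEquiv := X.galoisIdentification, isTempered := hTX
      isTempered_ker := by rw [hkerX]; exact hTX.subgroup_of_isClosed _ X.isClosed_deltaTemp
      isSlimGroup := isSlimGroup_prod hSlimΓ hslimG
      isSlimGroup_ker := by rw [hkerX]; exact isSlimGroup_of_continuousMulEquiv eX hSlimΓ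
      secondCountableTopology := inferInstanceAs (SecondCountableTopology (Γ × GQp p)) }
  have dY : Y.GroupLevelData :=
    { galEquiv := Y.galoisIdentification, isTempered := hTY
      isTempered_ker := by rw [hkerY]; exact hTY.subgroup_of_isClosed _ Y.isClosed_deltaTemp
      isSlimGroup := isSlimGroup_prod hSlimΓ₂ hslimG
      isSlimGroup_ker := by rw [hkerY]; exact isSlimGroup_of_continuousMulEquiv eY hSlimΓ₂
      secondCountableTopology := inferInstanceAs (SecondCountableTopology (Γ₂ × GQp p)) }
  -- the intrinsic residues
  have htfgX : IsTopologicallyFinitelyGenerated X.DeltaTemp := htfgΓ.of_denseRange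
    ({ toMonoidHom := eX.toMulEquiv.toMonoidHom, continuous_toFun := eX.continuous }) eX.surjective.denseRange
  have htfgY : IsTopologicallyFinitelyGenerated Y.DeltaTemp := htfgΓ₂.of_denseRange
    ({ toMonoidHom := eY.toMulEquiv.toMonoidHom, continuous_toFun := eY.continuous }) eY.surjective.denseRange
  have hCFY := cofreeCore_cofinal_index e₂ ι Γ₂ hΓ₂ (G := GQp p) hΔYeq htfgY
  have hminX := exists_isMinimalCofreeIn_index e ι Γ hΓ (G := GQp p) hΔXeq
  have hminY := exists_isMinimalCofreeIn_index e₂ ι Γ₂ hΓ₂ (G := GQp p) hΔYeq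
  obtain ⟨h1, h2⟩ := E.prop410iii_of_fDelta_surjective dX dY hsurj hCFY hminX hminY htfgX
  -- non-compactness: both `Π^tp` map onto `ℤ`
  have hncX : ¬ CompactSpace X.PiTemp :=
    not_compactSpace_of_continuous_surjective_int
      (((MonoidHom.snd P3 (Multiplicative ℤ)).comp Γ.subtype).comp (MonoidHom.fst Γ (GQp p)))
      ((continuous_snd.comp continuous_subtype_val).comp continuous_fst)
      fun n => by obtain ⟨γ, hγ⟩ := hsndΓ n; exact ⟨(γ, 1), hγ⟩
  have hncY : ¬ CompactSpace Y.PiTemp :=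
    not_compactSpace_of_continuous_surjective_int
      (((MonoidHom.snd P2 (Multiplicative ℤ)).comp Γ₂.subtype).comp (MonoidHom.fst Γ₂ (GQp p)))
      ((continuous_snd.comp continuous_subtype_val).comp continuous_fst)
      fun n => by obtain ⟨γ, hγ⟩ := hsndΓ₂ n; exact ⟨(γ, 1), hγ⟩
  exact ⟨X, Y, E, h1, h2, hsurj, ⟨dX⟩, ⟨dY⟩, hncX, hncY, ⟨(), trivial⟩, rfl, rfl⟩

end Literature.AnabelianGeometry.AbsoluteAnabelian.AbsTopI.Prop410

end
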